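import Mathlib
import Summits.Ventures.PercRepro2.Independence
import Summits.Ventures.PercRepro2.Harris
import Summits.Ventures.PercRepro2.HCov
import Summits.Ventures.PercRepro2.CutVertexPaths
import Summits.Ventures.PercRepro2.CutOneFarConn
import Summits.Ventures.PercRepro2.CutTwoFarConn
import Summits.Ventures.PercRepro2.CutTwoFarLaw
import Summits.Ventures.PercRepro2.CutTwoFar
import Summits.Ventures.PercRepro2.CutTwoFarHarris
import Summits.Ventures.PercRepro2.CutTwoFarRootsLaw
import Summits.Ventures.PercRepro2.CutTwoFarRightPat

/-!
# `a₃` and `b` behind a cut vertex, I: MARK CONNECTIVITY (blind cell PercRepro2, typer-1 g50)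

With `v` a cut vertex, `a₃, b` on the left and `o, a₁, a₂` on the right (or at `v`), every
connection between two marks is a Boolean function of the left pattern of `{v, a₃, b}` (`pat`)
and the right pattern of `{v, a₁, a₂, o}` (`rpat`, with `y₁ = a₁`, `y₂ = a₂`, `y₃ = o`):
`a_i ↔ a₃ ⟺ pat 0 ∧ rpat (v,a_i)`, `a_i ↔ b ⟺ pat 1 ∧ rpat (v,a_i)`, `a₁ ↔ a₂ ⟺ rpat 3`,
`a_i ↔ o ⟺ rpat (a_i,o)`, `a_i ↔ v ⟺ rpat (v,a_i)` (`ab_conn_*`).  Part I of the class theorem T4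
(MINE2-CUTVERTEX §13.2, S3.5 `{a₃, b}`).  Own work; standard axioms.
-/

namespace Summit.Ventures.PercRepro2

open CovForm CutVertexM9 UnionCluster

namespace CutTwoFar

section ABConn

variable {V : Type*} {E : Type*} [Fintype E] [DecidableEq E] {R : Type*} [Field R]
variable {ends : E → Sym2 V} {side : E → Bool} {L : Set V} {v : V} {Rt : Set V}

variable (h : CutVertex ends side L v Rt) {o b a₁ a₂ a₃ : V}
include h

omit [Fintype E] [DecidableEq E] in
/-- `a₁ ↔ a₃`: the left bit `a₃ ↔ v` and the right bit `v ↔ a₁`. -/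
lemma ab_conn_a₁_a₃ (h3 : a₃ ∈ L ∨ a₃ = v) (h1 : a₁ ∈ Rt ∨ a₁ = v) (ω : Config E) :
    Conn ends ω a₁ a₃ ↔ pat ends side v a₃ b ω 0 = true ∧ rpat ends side v a₁ a₂ o ω 0 = true := by
  rw [show Conn ends ω a₁ a₃ ↔ Conn ends ω a₃ a₁ from ⟨conn_symm, conn_symm⟩,
    conn_left_right_iff h h3 h1 ω, pat_zero_iff, Rb_eq_true_iff, rpat_zero_iff]

omit [Fintype E] [DecidableEq E] in
/-- `a₃ ↔ a₁`. -/
lemma ab_conn_a₃_a₁ (h3 : a₃ ∈ L ∨ a₃ = v) (h1 : a₁ ∈ Rt ∨ a₁ = v) (ω : Config E) :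
    Conn ends ω a₃ a₁ ↔ pat ends side v a₃ b ω 0 = true ∧ rpat ends side v a₁ a₂ o ω 0 = true := by
  rw [conn_left_right_iff h h3 h1 ω, pat_zero_iff, Rb_eq_true_iff, rpat_zero_iff]

omit [Fintype E] [DecidableEq E] in
/-- `a₂ ↔ a₃`. -/
lemma ab_conn_a₂_a₃ (h3 : a₃ ∈ L ∨ a₃ = v) (h2 : a₂ ∈ Rt ∨ a₂ = v) (ω : Config E) :
    Conn ends ω a₂ a₃ ↔ pat ends side v a₃ b ω 0 = true ∧ rpat ends side v a₁ a₂ o ω 1 = true := by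
  rw [show Conn ends ω a₂ a₃ ↔ Conn ends ω a₃ a₂ from ⟨conn_symm, conn_symm⟩,
    conn_left_right_iff h h3 h2 ω, pat_zero_iff, Rb_eq_true_iff, rpat_one_iff]

omit [Fintype E] [DecidableEq E] in
/-- `a₃ ↔ a₂`. -/
lemma ab_conn_a₃_a₂ (h3 : a₃ ∈ L ∨ a₃ = v) (h2 : a₂ ∈ Rt ∨ a₂ = v) (ω : Config E) :
    Conn ends ω a₃ a₂ ↔ pat ends side v a₃ b ω 0 = true ∧ rpat ends side v a₁ a₂ o ω 1 = true := by
  rw [conn_left_right_iff h h3 h2 ω, pat_zero_iff, Rb_eq_true_iff, rpat_one_iff]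

omit [Fintype E] [DecidableEq E] in
/-- `a₁ ↔ b`. -/
lemma ab_conn_a₁_b (hb : b ∈ L ∨ b = v) (h1 : a₁ ∈ Rt ∨ a₁ = v) (ω : Config E) :
    Conn ends ω a₁ b ↔ pat ends side v a₃ b ω 1 = true ∧ rpat ends side v a₁ a₂ o ω 0 = true := by
  rw [show Conn ends ω a₁ b ↔ Conn ends ω b a₁ from ⟨conn_symm, conn_symm⟩,
    conn_left_right_iff h hb h1 ω, pat_one_iff, Rb_eq_true_iff, rpat_zero_iff]

omit [Fintype E] [DecidableEq E] in
/-- `a₂ ↔ b`. -/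
lemma ab_conn_a₂_b (hb : b ∈ L ∨ b = v) (h2 : a₂ ∈ Rt ∨ a₂ = v) (ω : Config E) :
    Conn ends ω a₂ b ↔ pat ends side v a₃ b ω 1 = true ∧ rpat ends side v a₁ a₂ o ω 1 = true := by
  rw [show Conn ends ω a₂ b ↔ Conn ends ω b a₂ from ⟨conn_symm, conn_symm⟩,
    conn_left_right_iff h hb h2 ω, pat_one_iff, Rb_eq_true_iff, rpat_one_iff]

omit [Fintype E] [DecidableEq E] in
/-- `a₁ ↔ v`. -/
lemma ab_conn_a₁_v (h1 : a₁ ∈ Rt ∨ a₁ = v) (ω : Config E) :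
    Conn ends ω a₁ v ↔ rpat ends side v a₁ a₂ o ω 0 = true := by
  rw [conn_right_iff h h1 (Or.inr rfl) ω, rpat_zero_iff]
  exact ⟨conn_symm, conn_symm⟩

omit [Fintype E] [DecidableEq E] in
/-- `a₂ ↔ v`. -/
lemma ab_conn_a₂_v (h2 : a₂ ∈ Rt ∨ a₂ = v) (ω : Config E) :
    Conn ends ω a₂ v ↔ rpat ends side v a₁ a₂ o ω 1 = true := by
  rw [conn_right_iff h h2 (Or.inr rfl) ω, rpat_one_iff]
  exact ⟨conn_symm, conn_symm⟩

omit [Fintype E] [DecidableEq E] in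
/-- `a₂ ↔ a₁`. -/
lemma ab_conn_a₂_a₁ (h1 : a₁ ∈ Rt ∨ a₁ = v) (h2 : a₂ ∈ Rt ∨ a₂ = v) (ω : Config E) :
    Conn ends ω a₂ a₁ ↔ rpat ends side v a₁ a₂ o ω 3 = true := by
  rw [conn_right_iff h h2 h1 ω, rpat_three_iff]
  exact ⟨conn_symm, conn_symm⟩

omit [Fintype E] [DecidableEq E] in
/-- `a₁ ↔ a₂`. -/
lemma ab_conn_a₁_a₂ (h1 : a₁ ∈ Rt ∨ a₁ = v) (h2 : a₂ ∈ Rt ∨ a₂ = v) (ω : Config E) :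
    Conn ends ω a₁ a₂ ↔ rpat ends side v a₁ a₂ o ω 3 = true := by
  rw [conn_right_iff h h1 h2 ω, rpat_three_iff]

omit [Fintype E] [DecidableEq E] in
/-- `a₁ ↔ o`. -/
lemma ab_conn_a₁_o (h1 : a₁ ∈ Rt ∨ a₁ = v) (ho : o ∈ Rt ∨ o = v) (ω : Config E) :
    Conn ends ω a₁ o ↔ rpat ends side v a₁ a₂ o ω 4 = true := by
  rw [conn_right_iff h h1 ho ω, rpat_four_iff]

omit [Fintype E] [DecidableEq E] in
/-- `a₂ ↔ o`. -/
lemma ab_conn_a₂_o (h2 : a₂ ∈ Rt ∨ a₂ = v) (ho : o ∈ Rt ∨ o = v) (ω : Config E) :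
    Conn ends ω a₂ o ↔ rpat ends side v a₁ a₂ o ω 5 = true := by
  rw [conn_right_iff h h2 ho ω, rpat_five_iff]

end ABConn

end CutTwoFar

end Summit.Ventures.PercRepro2
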